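import Summits.BirchSwinnertonDyer.BirchSwinnertonDyer.Theorems.SignedLowerHalvesBDKimSignedCharValueRankZeroOfPoitouTateOdd
import HarnessLib

/-!
# `BDKimSignedCharValueRankZero` (routes `SignedLowerHalves`, `SignedBaseChange`; `PrintX6.InputKimCor315`; item
# stmt-BirchSwinnertonDyer-19288 = B. D. Kim 2013 Cor. 3.15 BY NAME) from the two Poitou–Tate ITEMS as filed — the one-liners

LADDER-BSD D-0154 (2) INPUTS→UNCONDITIONAL, INPUTS-LIST-2 row F10, tranche T9 sequel (desk `pub/bsd-wall/bsd-inputs`, seat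
`bsd-inputs-t9-p1`). The T9 file `…Theorems.SignedLowerHalvesBDKimSignedCharValueRankZeroOfPoitouTateOdd` proves
`KimCor315.cor315_of_poitouTate_two_rows : poitouTate_selmerStructure_duality ℚ → poitouTate_sha_tateDual ℚ →
BDKim2013.cor315_signedCharValue_rankZero` (odd supersingular `p`; no archimedean row). This file re-keys that to the texts of the
two REGISTERED Poitou–Tate items VERBATIM — stmt-BirchSwinnertonDyer-20461 `PoitouTateSelmerStructureDualityFact`
(`∀ K, poitouTate_selmerStructure_duality K`, Milne ADT I Thm. 4.10 for Selmer structures) and stmt-BirchSwinnertonDyer-20462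
`PoitouTateShaTateDualFact` (`∀ K, poitouTate_sha_tateDual K`, Milne ADT I Thm. 4.10 (a) / Cor. 4.16) — specialised at `K = ℚ`:
the item's own signature and the three route declarations that ARE it by definition, each by a one-line term.

HONEST FRAMING: every theorem here is CONDITIONAL — its two hypotheses are undischarged named facts (items 20461 / 20462 are
open; the tree has no `poitouTate_selmerStructure_duality_holds` / `poitouTate_sha_tateDual_holds`). Item 19288 is therefore NOT
closed by this file: its signature is the bare constant `BDKim2013.cor315_signedCharValue_rankZero`, and the closing one-liner
`cor315_of_poitouTateFacts h20461 h20462` can be written only the day both rows are discharged (append it HERE then, as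
`BDKimSignedCharValueRankZero_proof`). No summit statement is proved; the Birch–Swinnerton-Dyer conjecture is NOT proved by any
of this.

References: [BDKim2013] B. D. Kim, Compos. Math. 149 (2013), Cor. 3.15 (p. 199); [MilneADT2006] J. S. Milne, Arithmetic Duality
Theorems, 2nd ed., Ch. I Thm. 4.10 (p. 57), Cor. 4.16.
-/

set_option autoImplicit false
-- the Theorems namespace of this sub repeats the summit name by design (D-0017 nested layout)
set_option linter.dupNamespace false

namespace Summit.BirchSwinnertonDyer.BirchSwinnertonDyer.Theorems.KimCor315

open Literature.NumberTheory.GaloisCohomology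

/-- **B. D. Kim 2013 Cor. 3.15 BY NAME — item stmt-BirchSwinnertonDyer-19288's signature
`BDKim2013.cor315_signedCharValue_rankZero` — from the texts of the two registered Poitou–Tate items verbatim**
(stmt-BirchSwinnertonDyer-20461 `∀ K, poitouTate_selmerStructure_duality K`; stmt-BirchSwinnertonDyer-20462
`∀ K, poitouTate_sha_tateDual K`), specialised at `K = ℚ` and fed to `cor315_of_poitouTate_two_rows`. CONDITIONAL: both rows
are undischarged named facts, so this does NOT close item 19288; BSD is not proved by this. [cite: BDKim2013, Cor. 3.15 (p. 199)]
[cite: MilneADT2006, Ch. I, Thm. 4.10, Cor. 4.16] -/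
theorem cor315_of_poitouTateFacts
    (hPTs : ∀ (K : Type) [Field K] [NumberField K], poitouTate_selmerStructure_duality K)
    (hPT : ∀ (K : Type) [Field K] [NumberField K], poitouTate_sha_tateDual K) :
    Literature.NumberTheory.EllipticCurves.BDKim2013.cor315_signedCharValue_rankZero :=
  cor315_of_poitouTate_two_rows (hPTs ℚ) (hPT ℚ)

/-- **Route `SignedLowerHalves`, decl `BDKimSignedCharValueRankZero` (item stmt-BirchSwinnertonDyer-19288), from the texts of
items 20461 / 20462 verbatim** — the route declaration is by definition the named fact. CONDITIONAL; the item is NOT closed by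
this; BSD is not proved by this. [cite: BDKim2013, Cor. 3.15 (p. 199)] [cite: MilneADT2006, Ch. I, Thm. 4.10, Cor. 4.16] -/
theorem signedLowerHalves_bdKimSignedCharValueRankZero_of_poitouTateFacts
    (hPTs : ∀ (K : Type) [Field K] [NumberField K], poitouTate_selmerStructure_duality K)
    (hPT : ∀ (K : Type) [Field K] [NumberField K], poitouTate_sha_tateDual K) :
    Summit.BirchSwinnertonDyer.BirchSwinnertonDyer.Theses.SignedLowerHalves.BDKimSignedCharValueRankZero := by
  unfold Summit.BirchSwinnertonDyer.BirchSwinnertonDyer.Theses.SignedLowerHalves.BDKimSignedCharValueRankZero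
  exact cor315_of_poitouTateFacts hPTs hPT

/-- **Route `SignedBaseChange`, decl `BDKimSignedCharValueRankZero` (item stmt-BirchSwinnertonDyer-19288), from the texts of
items 20461 / 20462 verbatim.** CONDITIONAL; the item is NOT closed by this; BSD is not proved by this.
[cite: BDKim2013, Cor. 3.15 (p. 199)] [cite: MilneADT2006, Ch. I, Thm. 4.10, Cor. 4.16] -/
theorem signedBaseChange_bdKimSignedCharValueRankZero_of_poitouTateFacts
    (hPTs : ∀ (K : Type) [Field K] [NumberField K], poitouTate_selmerStructure_duality K)
    (hPT : ∀ (K : Type) [Field K] [NumberField K], poitouTate_sha_tateDual K) :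
    Summit.BirchSwinnertonDyer.BirchSwinnertonDyer.Theses.SignedBaseChange.BDKimSignedCharValueRankZero := by
  unfold Summit.BirchSwinnertonDyer.BirchSwinnertonDyer.Theses.SignedBaseChange.BDKimSignedCharValueRankZero
  exact cor315_of_poitouTateFacts hPTs hPT

/-- **Route `PrintX6`, decl `InputKimCor315` (item stmt-BirchSwinnertonDyer-19288), from the texts of items 20461 / 20462
verbatim.** CONDITIONAL; the item is NOT closed by this; BSD is not proved by this. [cite: BDKim2013, Cor. 3.15 (p. 199)]
[cite: MilneADT2006, Ch. I, Thm. 4.10, Cor. 4.16] -/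
theorem printX6_inputKimCor315_of_poitouTateFacts
    (hPTs : ∀ (K : Type) [Field K] [NumberField K], poitouTate_selmerStructure_duality K)
    (hPT : ∀ (K : Type) [Field K] [NumberField K], poitouTate_sha_tateDual K) :
    Summit.BirchSwinnertonDyer.BirchSwinnertonDyer.Theses.PrintX6.InputKimCor315 := by
  unfold Summit.BirchSwinnertonDyer.BirchSwinnertonDyer.Theses.PrintX6.InputKimCor315
  exact cor315_of_poitouTateFacts hPTs hPT

end Summit.BirchSwinnertonDyer.BirchSwinnertonDyer.Theorems.KimCor315
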